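import Summits.Ventures.YMGap.Conjectures.StrongCouplingSUNSchwingerDysonBetaSite
import HarnessLib
import HarnessLib.Audit.Tags

/-!
# The Schwinger–Dyson side for `SU(N)` at `β ≥ 0` (4/4): the volume-uniform Schwinger–Dyson bound REDUCED
# TO THE BARYON DENSITY, and chiral long-range order at small `β > 0` for `SU(N)` given a baryon-density bound

Cell `pub-ymgap`, seat qcd-lit g27 (literature-prover), `bears_on: Q1` — «what an `SU(N)` extension of
Salmhofer–Seiler to small `β > 0` needs», typed.  Everything is a theorem (0 facts, 0 sorry).

* `sdBoundSU N ν β p = (2N)² (N - 2νκ(β) - N p)/(N² e^{βc} + κ(β))` — the explicit, volume-independent constant;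
  `sdBoundSU N ν 0 p = 4N(1 - p)` (`sdBoundSU_zero`), continuous at `β = 0` (`tendsto_sdBoundSU`), antitone in `p`;
* **`schwingerDyson_bound_SU`** — THE SCHWINGER–DYSON LOWER BOUND FOR `SU(N)` AT `β ≥ 0`, UNIFORMLY IN THE
  VOLUME, IN TERMS OF THE BARYON DENSITY: for `N` odd `≥ 3`, every `β ≥ 0` and every even `L`,
  `∑_μ (T_β(0,e_μ) + T_β(0,-e_μ)) ≥ sdBoundSU N ν β (P_B^β(0))`, `T_β = suTwoPointB N ν L β`,
  `P_B^β = baryonDensitySU N ν L β` (`sd_base_SU` at the even site `0`, `S_β(1) > 0`, `T_β = (2N)² S_β((σσ))/S_β(1)`);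
* **`chiralLRO_SU_of_baryonDensity`** — for `N` odd `≥ 3`, `ν ≥ 4`: IF the baryon density is bounded,
  `P_B^β(0) ≤ p₀` for all `0 ≤ β < β₀` and all even `L ≥ L₀`, with `p₀ < 1 - 2S(ν)` (`S(4) < 0.35`), THEN there are
  `β₁ > 0`, `c > 0`, `L₁` with `|Λ|⁻¹ ∑_x T_β(0,x) ≥ c` for all `0 ≤ β < β₁` and all even `L ≥ L₁` — by g26's
  reduction `chiralLRO_SU_of_SD` (infrared bound at every `β ≥ 0`, Gaussian domination, symmetries, grading).

So the ONE missing input for «`SU(3)`, one massless staggered flavour, small `β > 0`, `ν = 4`: chiral LRO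
uniformly in the volume» along the Salmhofer–Seiler road is now located as A VOLUME-UNIFORM BOUND ON THE
BARYON DENSITY `P_B^β(0) ≤ p₀ < 1 - 2S(4) ≈ 0.30` at small `β` — at `β = 0` the tree's `sum_nbr_fermiExpectSU_ge_torus`
controls the same signed long-loop weight by loop surgery in the monomer–dimer–polymer representation (and gets
the sharper `4N`); no `β > 0` substitute is in print (Salmhofer–Seiler §5 p. 424 leave `SU(N)` open).

Honest framing: finite even tori `(ℤ/Lℤ)^ν`, one staggered flavour, massless, `N` odd `≥ 3`; the first theorem
is unconditional but only as strong as the (unknown) size of `P_B^β`; the last is CONDITIONAL on the displayed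
baryon-density bound, which is NOT proved here or in print.  Nothing about the thermodynamic limit of the state,
the continuum, or the summit's QCD conjunct; YM mass gap (Clay) untouched.

## References
* [SalmhoferSeiler1991] M. Salmhofer, E. Seiler, Commun. Math. Phys. 139 (1991) 395–432, Thm. 4.8 (4.38)–(4.42),
  Cor. 4.9, Remark 4.5, §5 p. 424.
* [SeilerLNP1982] E. Seiler, LNP 159 (1982), Ch. 2.
* [FrommForcrand2008] M. Fromm, Ph. de Forcrand, arXiv:0811.1931, (4)–(7).
-/

noncomputable section

open MeasureTheory Finset
open scoped ComplexConjugate Matrix BigOperators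
open Literature.MathematicalPhysics.QuantumFieldTheory (Site Edge GaugeConfig wilsonAction haarProbability)
open Literature.MathematicalPhysics.QuantumLattice
open Literature.MathematicalPhysics.QuantumLattice.GrassmannAlgebra
open Literature.MathematicalPhysics.QuantumLattice.StrongCoupling
open Literature.MathematicalPhysics.StatisticalMechanics
open Literature.Probability.LatticeModels (TorusSite)

namespace Summit.Ventures.YMGap.Conjectures

namespace SchwingerDysonSU

open SchwingerDyson MesonWeightSU

variable {N ν L : ℕ} [NeZero ν] [NeZero L] [LinearOrder (TorusSite ν L)]

/-! ### The explicit constant -/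

variable (N ν) in
/-- **The volume-independent Schwinger–Dyson constant for `SU(N)` at coupling `β` and baryon density `p`**:
`b(β, p) = (2N)² (N - 2νκ(β) - N p)/(N² e^{βc} + κ(β))`, `c = linkOsc ν N`, `κ = kap N ν`. [cite: SalmhoferSeiler1991, Thm. 4.8 (4.38), §5 p. 424] -/
def sdBoundSU (β p : ℝ) : ℝ :=
  (2 * N : ℝ) ^ 2 * (((N : ℝ) - 2 * ν * kap N ν β - N * p) / ((N : ℝ) ^ 2 * Real.exp (β * linkOsc ν N) + kap N ν β))

omit [NeZero ν] [NeZero L] [LinearOrder (TorusSite ν L)] in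
/-- `b(0, p) = 4N(1 - p)`. [cite: SalmhoferSeiler1991, Thm. 4.8 (4.38)] -/
theorem sdBoundSU_zero (hN : N ≠ 0) (p : ℝ) : sdBoundSU N ν 0 p = 4 * N * (1 - p) := by
  have hN0 : (N : ℝ) ≠ 0 := by exact_mod_cast hN
  rw [sdBoundSU, kap_zero]
  simp only [mul_zero, sub_zero, zero_mul, Real.exp_zero, mul_one, add_zero]
  field_simp
  ring

omit [NeZero ν] [NeZero L] [LinearOrder (TorusSite ν L)] in
/-- `b(β, ·)` is antitone for `β ≥ 0`. [cite: SalmhoferSeiler1991, Thm. 4.8 (4.38)] -/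
theorem sdBoundSU_anti (hN : N ≠ 0) {β : ℝ} (hβ : 0 ≤ β) {p q : ℝ} (hpq : p ≤ q) : sdBoundSU N ν β q ≤ sdBoundSU N ν β p := by
  have hκ := kap_nonneg (N := N) (ν := ν) hβ
  have hD : 0 < (N : ℝ) ^ 2 * Real.exp (β * linkOsc ν N) + kap N ν β := by positivity
  unfold sdBoundSU
  refine mul_le_mul_of_nonneg_left (div_le_div_of_nonneg_right ?_ hD.le) (by positivity)
  nlinarith [Nat.cast_nonneg (α := ℝ) N]

omit [NeZero ν] [NeZero L] [LinearOrder (TorusSite ν L)] in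
/-- **`b(β, p) → 4N(1 - p)` as `β → 0`.** [cite: SalmhoferSeiler1991, Thm. 4.8 (4.38)–(4.39)] -/
theorem tendsto_sdBoundSU (hN : N ≠ 0) (p : ℝ) :
    Filter.Tendsto (fun β => sdBoundSU N ν β p) (nhds 0) (nhds (4 * N * (1 - p) : ℝ)) := by
  have hN0 : (N : ℝ) ≠ 0 := by exact_mod_cast hN
  rw [← sdBoundSU_zero (ν := ν) hN p]
  have hk := continuous_kap (N := N) (ν := ν)
  have hc : ContinuousAt (fun β => sdBoundSU N ν β p) 0 := by
    unfold sdBoundSU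
    refine ContinuousAt.mul continuousAt_const (ContinuousAt.div (by fun_prop) (by fun_prop) ?_)
    rw [kap_zero]; simp [hN0]
  exact hc.tendsto

/-! ### The Schwinger–Dyson lower bound at `β ≥ 0` in terms of the baryon density -/

/-- **THE SCHWINGER–DYSON LOWER BOUND FOR `SU(N)` AT `β ≥ 0`, UNIFORMLY IN THE VOLUME, IN TERMS OF THE BARYON
DENSITY**: for `N` odd `≥ 3`, every `β ≥ 0` and every even `L`,
`∑_μ (T_β(0,e_μ) + T_β(0,-e_μ)) ≥ (2N)² (N - 2νκ(β) - N P_B^β(0))/(N² e^{βc} + κ(β))`; at `β = 0` the right side is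
`4N(1 - P_B(0))`. [cite: SalmhoferSeiler1991, Thm. 4.8 (4.38)–(4.39), §5 p. 424] -/
theorem schwingerDyson_bound_SU (hN : Odd N) (h1 : 1 < N) (hL : Even L) {β : ℝ} (hβ : 0 ≤ β) :
    sdBoundSU N ν β (baryonDensitySU N ν L β 0) ≤
      ∑ μ : Fin ν, (suTwoPointB N ν L β 0 (Pi.single μ 1) + suTwoPointB N ν L β 0 (-Pi.single μ 1)) := by
  have hN0 : N ≠ 0 := by omega
  have hL1 : 1 < L := StaggeredRP.one_lt_of_even_neZero hL
  have hS1 := suSB_one_pos (ν := ν) (L := L) hN h1 hL β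
  have hsite := sd_base_SU hL (Nat.pos_of_ne_zero hN0) hβ (zero_mem_evens (ν := ν) (L := L))
  have hQ : ∑ e ∈ bondsAt ν L 0, baryonLinkSU N ν L β 0 e 1 = baryonDensitySU N ν L β 0 * suSB N ν L β 1 := by
    rw [baryonDensitySU, div_mul_cancel₀ _ hS1.ne']
  rw [hQ, sum_bondsAt hL1] at hsite
  simp only [torusLinks, zero_add, zero_sub, neg_add_cancel] at hsite
  have hterm : ∀ μ : Fin ν, suTwoPointB N ν L β 0 (Pi.single μ 1) + suTwoPointB N ν L β 0 (-Pi.single μ 1) =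
      (2 * N : ℝ) ^ 2 * ((suSB N ν L β (spinPair 0 (Pi.single μ 1)) +
        suSB N ν L β (spinPair (-Pi.single μ 1 : TorusSite ν L) 0)) / suSB N ν L β 1) := by
    intro μ
    rw [suTwoPointB_eq_suSB_div hN0 hL, suTwoPointB_eq_suSB_div hN0 hL, spinPair_comm (0 : TorusSite ν L) (-Pi.single μ 1)]
    ring
  simp_rw [hterm]
  rw [← Finset.mul_sum, ← Finset.sum_div, sdBoundSU]
  refine mul_le_mul_of_nonneg_left ?_ (by positivity)
  have hκ := kap_nonneg (N := N) (ν := ν) hβ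
  have hDpos : 0 < (N : ℝ) ^ 2 * Real.exp (β * linkOsc ν N) + kap N ν β := by positivity
  rw [div_le_div_iff₀ hDpos hS1]
  have hring : ((N : ℝ) - 2 * ν * kap N ν β - N * baryonDensitySU N ν L β 0) * suSB N ν L β 1 =
      ((N : ℝ) - 2 * ν * kap N ν β) * suSB N ν L β 1 - (N : ℝ) * (baryonDensitySU N ν L β 0 * suSB N ν L β 1) := by ring
  rw [hring]
  linarith [hsite]

/-- **At `β = 0`**: `∑_μ (T(0,e_μ) + T(0,-e_μ)) ≥ 4N (1 - P_B(0))` for the `β = 0` kernel `suTwoPoint` of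
`…SUNChiralLROMesonWeight` (`N` odd `≥ 3`, even `L`) — to be compared with the tree's unconditional `4N`
(`sum_suTwoPoint_nbr_ge`, loop surgery). [cite: SalmhoferSeiler1991, Lemma 4.7 (4.38), §5 p. 424] [cite: FrommForcrand2008, (4)–(7)] -/
theorem schwingerDyson_bound_SU_zero (hN : Odd N) (h1 : 1 < N) (hL : Even L) :
    4 * (N : ℝ) * (1 - baryonDensitySU N ν L 0 0) ≤
      ∑ μ : Fin ν, (suTwoPoint N ν L 0 (Pi.single μ 1) + suTwoPoint N ν L 0 (-Pi.single μ 1)) := by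
  have h := schwingerDyson_bound_SU (ν := ν) (L := L) hN h1 hL le_rfl
  rw [sdBoundSU_zero (by omega)] at h
  simpa only [suTwoPointB_zero hL] using h

/-! ### Chiral long-range order at small `β > 0` for `SU(N)`, given a bound on the baryon density -/

/-- **CHIRAL LONG-RANGE ORDER FOR `SU(N)`, `N` ODD `≥ 3`, ONE MASSLESS STAGGERED FLAVOUR, `ν ≥ 4`, AT SMALL `β > 0`,
UNIFORMLY IN THE VOLUME — CONDITIONAL ON A BARYON-DENSITY BOUND.**  If `P_B^β(0) ≤ p₀` for all `0 ≤ β < β₀` and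
all even `L ≥ L₀` (any ordering of the Grassmann generators), with `p₀ < 1 - 2S(ν)`, then there are `β₁ > 0`, `c > 0`,
`L₁` with `|Λ|⁻¹∑_x T_β(0,x) ≥ c` for all `0 ≤ β < β₁` and all even `L ≥ L₁`.  Inputs: `schwingerDyson_bound_SU`,
`b(β,p₀) → 4N(1-p₀) > 2·4N·S(ν)`, and g26's `chiralLRO_SU_of_SD` (infrared bound at every `β ≥ 0`, reflection
positivity, Gaussian domination, symmetries, `Z_β ≠ 0`, `kernel_chiralLRO_uniform`).  The hypothesis is NOT proved
here or in print. [cite: SalmhoferSeiler1991, Thm. 4.8, Cor. 4.9 (4.41)–(4.42), Remark 4.5, §5 p. 424] -/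
theorem chiralLRO_SU_of_baryonDensity (hN : Odd N) (h1 : 1 < N) (hν : 4 ≤ ν) {β₀ p₀ : ℝ} (hβ₀ : 0 < β₀)
    (hp₀ : p₀ < 1 - 2 * ComplexSpin.fluctS ν) {L₀ : ℕ}
    (hPB : ∀ β : ℝ, 0 ≤ β → β < β₀ → ∀ (L : ℕ) [NeZero L] [LinearOrder (TorusSite ν L)], Even L → L₀ ≤ L →
      baryonDensitySU N ν L β 0 ≤ p₀) :
    ∃ β₁ : ℝ, 0 < β₁ ∧ ∃ c : ℝ, 0 < c ∧ ∃ L₁ : ℕ, ∀ β : ℝ, 0 ≤ β → β < β₁ →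
      ∀ (L : ℕ) [NeZero L] [LinearOrder (TorusSite ν L)], Even L → L₁ ≤ L → c ≤ suChiralOrderB N ν L β := by
  have hN0 : N ≠ 0 := by omega
  have hNpos : (0 : ℝ) < N := by exact_mod_cast Nat.pos_of_ne_zero hN0
  have hS0 := ComplexSpin.fluctS_nonneg ν
  -- the margin: `2·4N·S(ν) < b < 4N(1 - p₀)`
  set b : ℝ := (2 * (4 * (N : ℝ)) * ComplexSpin.fluctS ν + 4 * N * (1 - p₀)) / 2 with hb_def
  have hgap : 2 * (4 * (N : ℝ)) * ComplexSpin.fluctS ν < 4 * N * (1 - p₀) := by nlinarith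
  have hb : 2 * (4 * (N : ℝ)) * ComplexSpin.fluctS ν < b := by rw [hb_def]; linarith
  have hb' : b < 4 * N * (1 - p₀) := by rw [hb_def]; linarith
  -- continuity of the constant at `β = 0`
  obtain ⟨δ, hδ, hδb⟩ := Metric.tendsto_nhds_nhds.mp (tendsto_sdBoundSU (ν := ν) hN0 p₀) (4 * N * (1 - p₀) - b) (by linarith)
  refine ⟨min β₀ δ, lt_min hβ₀ hδ, ?_⟩
  have hSD : ∀ β : ℝ, 0 ≤ β → β < min β₀ δ → ∀ (L : ℕ) [NeZero L] [LinearOrder (TorusSite ν L)], Even L → L₀ ≤ L →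
      b ≤ ∑ μ : Fin ν, (suTwoPointB N ν L β 0 (Pi.single μ 1) + suTwoPointB N ν L β 0 (-Pi.single μ 1)) := by
    intro β hβ hβ1 L _ _ hE hLe
    have hβ₀' : β < β₀ := lt_of_lt_of_le hβ1 (min_le_left _ _)
    have hβδ : β < δ := lt_of_lt_of_le hβ1 (min_le_right _ _)
    have hd : dist β 0 < δ := by rw [dist_zero_right, Real.norm_eq_abs, abs_of_nonneg hβ]; exact hβδ
    have hclose := hδb hd
    rw [Real.dist_eq] at hclose
    have hlow : b ≤ sdBoundSU N ν β p₀ := by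
      have := (abs_lt.mp hclose).1
      linarith
    exact hlow.trans ((sdBoundSU_anti hN0 hβ (hPB β hβ hβ₀' L hE hLe)).trans (schwingerDyson_bound_SU hN h1 hE hβ))
  exact chiralLRO_SU_of_SD hN0 hν hb hSD

end SchwingerDysonSU

end Summit.Ventures.YMGap.Conjectures

end
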